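import Summits.BirchSwinnertonDyer.BirchSwinnertonDyer.Theorems.ManinLocalTwoThreeTranslationStableTwistInvariance
import Summits.BirchSwinnertonDyer.BirchSwinnertonDyer.Theorems.ManinLocalTwoThreeSameLevelTwistTransport
import Summits.BirchSwinnertonDyer.Rank1Residual.ManinAdditive.TwistOrbitDegreeIdentity
import HarnessLib

/-!
# E-desc-62 `CongruenceNumberTwistInvarianceAtThree` IS A THEOREM: the congruence number is constant on same-level
# `χ₋₃`-twist pairs (`9 ∣ N`) — via the Petersson self-adjoint integral involution `B₃` of `S₂(Γ₀(N); ℤ)`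

Summit `BirchSwinnertonDyer`, sub-problem `BirchSwinnertonDyer`, route `ManinLocalTwoThree` (Manin constant at the
additive primes `2, 3`); width seat `bsd-line-manin23-p2` (gen 9), `--supports` the crux C3 `ManinPrimeToThreeAtNine`
(stmt-BirchSwinnertonDyer-22968).  Cell `bsd-f2-manin`, descent lens desc g9 (MEMO-desc §26.5, CANDIDATES row E-desc-62
«THEOREM on paper», typed in HOME/desc/g9/Sketch-desc-g9.lean :134 — not filed under W-71; this file states the row with
the sketch's binders VERBATIM as a theorem).  Refuter ask R-desc-14 (proof audit) is answered by the kernel.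

PROVED here (sorry-free):

* `twistOperatorAtThree_mem_integralCuspForms0` — `B₃` preserves `S₂(Γ₀(N); ℤ)` (`9 ∣ N`; `aₙ(B₃ x) = (n/3) aₙ(x)`);
* `congruenceNumber_eq_of_twistOperatorAtThree_swap` — `B₃ f = g`, `B₃ g = f` ⇒ `r_f = r_g` (this seat's g8
  `lineIndex_eq_of_twistOperatorAtThree_swap` on `M = S₂(Γ₀(N); ℤ)`, where `lineIndex = congruenceNumber`);
* **`congruenceNumber_charTwist_of_isNewform0`** — newform level: `r_{f ⊗ χ₋₃} = r_f` for EVERY newform `f` on `Γ₀(N)`,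
  `9 ∣ N` (no hypothesis on the twist: `B₃(f ⊗ χ) = f` by `3`-depletion);
* `congruenceNumber_eq_of_isIsogenous_quadraticTwist_negThree` — curve level, any common level `9 ∣ N` of the two data:
  `W, W′` additive at `3`, `W ⊗ (−3) ∼ W′` ⇒ `r_{D.f} = r_{D′.f}` (`aₙ(f_{W′}) = (n/3)·aₙ(f_W)`, tree
  `cuspCoeff_eq_chi_mul_of_twist_pStar`, Knapp Thm. 11.67 `LFunction_eq_of_isIsogenous_holds`);
* **`congruenceNumberTwistInvarianceAtThree`** — E-desc-62 with desc g9's binders verbatim: data at the conductors,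
  `9 ∣ N_W`, `N_{W′} = N_W`, `IsIsogenous (W ⊗ (−3)) W′` ⇒ `congruenceNumber D.f = congruenceNumber D′.f`.

Census of record (desc g9 `rinvar.py` on the cell table CONGNUM-N1500): 235/235 same-level `χ₋₃` pairs `N ≤ 1500` have
`r = r′` (185 JUMP + 50 FLAT).  With ARS 2012 Thm. 2.1 (`m ∣ r`) and the degree jump this explains the `9 ∣ N` rows
54B1, 99A1, 135A1 (`r = 3m`) of ARS Table 1 (desc's proved edge `three_mul_modularDegree_dvd_congruenceNumber_of_jump`).
Elementary (Atkin–Lehner 1970 §4; Diamond–Shurman §5.5; Stevens 1989 (5.5)).  BSD is not proved by this; Manin's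
conjecture is not proved by this; C3 is not closed by this.
-/

set_option autoImplicit false
set_option linter.dupNamespace false

noncomputable section

open scoped MatrixGroups ModularForm
open CongruenceSubgroup WeierstrassCurve
open Literature.NumberTheory.EllipticCurves Literature.NumberTheory.EllipticCurves.ModularForms
open Summit.BirchSwinnertonDyer.Rank1Residual.ManinAdditive
open Summit.BirchSwinnertonDyer.Rank1Residual.ManinAdditive.RamanujanCut
open Summit.BirchSwinnertonDyer.Rank1Residual.ManinAdditive.ConwayNortonThree

namespace Summit.BirchSwinnertonDyer.BirchSwinnertonDyer.Theorems.ManinLocalTwoThree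

variable {N : ℕ} [NeZero N]

/-! ### `B₃` is an integral operator -/

/-- **`B₃` preserves `S₂(Γ₀(N); ℤ)`** (`9 ∣ N`): `aₙ(B₃ x) = (n/3)·aₙ(x)` with the Legendre symbol `(n/3) ∈ ℤ`. -/
theorem twistOperatorAtThree_mem_integralCuspForms0 (h9 : 9 ∣ N) {x : CuspForm (Gamma0 N) 2}
    (hx : x ∈ integralCuspForms0 N 2) : twistOperatorAtThree N 2 x ∈ integralCuspForms0 N 2 := by
  haveI : Fact (Nat.Prime 3) := ⟨Nat.prime_three⟩
  intro n
  obtain ⟨z, hz⟩ := hx n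
  refine ⟨legendreSym 3 n * z, ?_⟩
  rw [cuspCoeff_twistOperatorAtThree_two h9 (isQuadratic_quadraticChar_ringHomComp 3)
    (isPrimitive_quadraticChar_ringHomComp 3 (by norm_num)), ← hz, quadraticChar_ringHomComp_apply_natCast]
  push_cast
  ring

/-- `S₂(Γ₀(N); ℤ)` is `B₃`-stable (`9 ∣ N`). -/
theorem map_twistOperatorAtThree_integralCuspForms0_le (h9 : 9 ∣ N) :
    (integralCuspForms0 N 2).map ((twistOperatorAtThree N 2).restrictScalars ℤ) ≤ integralCuspForms0 N 2 := by
  rintro _ ⟨x, hx, rfl⟩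
  exact twistOperatorAtThree_mem_integralCuspForms0 h9 hx

/-- **`r_f = r_g` whenever `B₃ f = g` and `B₃ g = f`** (`9 ∣ N`): the congruence number is the `f`-line index of the
`B₃`-stable lattice `S₂(Γ₀(N); ℤ)`, and `B₃` is Petersson self-adjoint. -/
theorem congruenceNumber_eq_of_twistOperatorAtThree_swap (h9 : 9 ∣ N) {f g : CuspForm (Gamma0 N) 2}
    (hf : twistOperatorAtThree N 2 f = g) (hg : twistOperatorAtThree N 2 g = f) :
    congruenceNumber f = congruenceNumber g := by
  rw [← lineIndex_integralCuspForms0, ← lineIndex_integralCuspForms0]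
  exact lineIndex_eq_of_twistOperatorAtThree_swap (map_twistOperatorAtThree_integralCuspForms0_le h9) hf hg

/-! ### E-desc-62 at newform level -/

/-- **The congruence number of a newform at `9 ∣ N` is invariant under the `χ₋₃`-twist**: `r_{f ⊗ χ₋₃} = r_f` for every
newform `f ∈ S₂(Γ₀(N))` and the primitive quadratic character `χ` mod `3` (`B₃ f = f ⊗ χ` by E-desc-51′, `B₃(f ⊗ χ) = f`
because `f` is `3`-depleted).  No hypothesis on the level of `f ⊗ χ`. -/
theorem congruenceNumber_charTwist_of_isNewform0 (h9 : 3 ^ 2 ∣ N) {χ : DirichletCharacter ℂ 3} (hχ : χ.IsQuadratic)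
    (hprim : χ.IsPrimitive) {f : CuspForm (Gamma0 N) 2} (hf : IsNewform0 f) :
    congruenceNumber (charTwist N dvd_rfl h9 hχ f) = congruenceNumber f :=
  (congruenceNumber_eq_of_twistOperatorAtThree_swap (by simpa using h9) (twistOperatorEqCharTwist_holds N h9 χ hχ hprim f)
    (twistOperatorAtThree_charTwist_of_isNewform0 h9 hχ hprim hf)).symm

/-! ### E-desc-62 at curve level -/

/-- **Same-level `(−3)`-twist pairs have equal congruence numbers** (any common level `N` with `9 ∣ N` of the two data;
`W`, `W′` additive at `3`): `aₙ(f_{W′}) = (n/3)·aₙ(f_W)` for all `n` (Stevens (5.5); both sides vanish for `3 ∣ n`), so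
`B₃ f_W = f_{W′}` and `B₃ f_{W′} = f_W`. -/
theorem congruenceNumber_eq_of_isIsogenous_quadraticTwist_negThree {W W' : WeierstrassCurve ℚ} [W.IsElliptic]
    [W'.IsElliptic] {N N' : ℕ} [NeZero N] [NeZero N'] (D : ModularParametrizationData W N)
    (D' : ModularParametrizationData W' N') (hNN' : N' = N) (h9 : 9 ∣ N) (h9W : 9 ∣ W.conductorNorm ℤ)
    (h9W' : 9 ∣ W'.conductorNorm ℤ) (hiso : IsIsogenous (W.quadraticTwist ((-3 : ℤ) : ℚ)) W') :
    congruenceNumber D.f = congruenceNumber D'.f := by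
  subst hNN'
  haveI : Fact (Nat.Prime 3) := ⟨Nat.prime_three⟩
  have hW : ¬ W.HasGoodReductionAtPrime 3 ∧ ¬ W.HasMultiplicativeReductionAtPrime 3 :=
    not_good_and_not_mult_of_sq_dvd_conductorNorm W (by simpa using h9W)
  have hW' : ¬ W'.HasGoodReductionAtPrime 3 ∧ ¬ W'.HasMultiplicativeReductionAtPrime 3 :=
    not_good_and_not_mult_of_sq_dvd_conductorNorm W' (by simpa using h9W')
  have hW0 : ∀ n : ℕ, 3 ∣ n → W.LFunction n = 0 := fun n hn =>
    W.LFunction_apply_eq_zero_of_not_good_of_not_mult 3 hW.1 hW.2 hn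
  have hW'0 : ∀ n : ℕ, 3 ∣ n → W'.LFunction n = 0 := fun n hn =>
    W'.LFunction_apply_eq_zero_of_not_good_of_not_mult 3 hW'.1 hW'.2 hn
  have hd : (((-1 : ℤ) ^ (3 / 2) * 3 : ℤ) : ℚ) = ((-3 : ℤ) : ℚ) := by norm_num
  haveI : (W.quadraticTwist ((-3 : ℤ) : ℚ)).IsElliptic := W.isElliptic_quadraticTwist (by norm_num)
  have hu : (1 : VariableChange ℚ) • W.quadraticTwist (((-1 : ℤ) ^ (3 / 2) * 3 : ℤ) : ℚ) =
      W.quadraticTwist ((-3 : ℤ) : ℚ) := by rw [one_smul, hd]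
  have hLC : (W.quadraticTwist ((-3 : ℤ) : ℚ)).LFunction = W'.LFunction := LFunction_eq_of_isIsogenous_holds _ _ hiso
  have hcoef' : ∀ n : ℕ, cuspCoeff D'.f n =
      (quadraticChar (ZMod 3)).ringHomComp (Int.castRingHom ℂ) n * cuspCoeff D.f n := fun n =>
    cuspCoeff_eq_chi_mul_of_twist_pStar (by norm_num) 1 hu hLC hW'0 D D' n
  have hcoef : ∀ n : ℕ, cuspCoeff D.f n =
      (quadraticChar (ZMod 3)).ringHomComp (Int.castRingHom ℂ) n * cuspCoeff D'.f n := fun n =>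
    cuspCoeff_eq_chi_mul_of_twist_pStar' (by norm_num) 1 hu hLC hW0 D D' n
  have hχ := isQuadratic_quadraticChar_ringHomComp 3
  have hprim := isPrimitive_quadraticChar_ringHomComp 3 (by norm_num)
  have hB : twistOperatorAtThree _ 2 D.f = D'.f :=
    eq_of_forall_cuspCoeff_eq_gamma0 fun n => by rw [cuspCoeff_twistOperatorAtThree_two h9 hχ hprim, hcoef' n]
  have hB' : twistOperatorAtThree _ 2 D'.f = D.f :=
    eq_of_forall_cuspCoeff_eq_gamma0 fun n => by rw [cuspCoeff_twistOperatorAtThree_two h9 hχ hprim, hcoef n]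
  exact congruenceNumber_eq_of_twistOperatorAtThree_swap h9 hB hB'

/-- **E-desc-62 `CongruenceNumberTwistInvarianceAtThree` IS A THEOREM** (cell `bsd-f2-manin`, desc g9 MEMO-desc §26.5;
binders VERBATIM from HOME/desc/g9/Sketch-desc-g9.lean :134): for modular parametrisation data `D, D′` of `W, W′` at
their (equal) conductor `N` with `9 ∣ N` and `W ⊗ (−3) ∼ W′`, the congruence numbers of the two newforms agree,
`r_{D.f} = r_{D′.f}` — the congruence number is constant on same-level `χ₋₃`-twist orbits; no optimality hypothesis.
BSD is not proved by this; Manin's conjecture is not proved by this. -/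
theorem congruenceNumberTwistInvarianceAtThree :
    ∀ (W W' : WeierstrassCurve ℚ) [W.IsElliptic] [W'.IsElliptic] [NeZero (W.conductorNorm ℤ)]
      [NeZero (W'.conductorNorm ℤ)] (D : ModularParametrizationData W (W.conductorNorm ℤ))
      (D' : ModularParametrizationData W' (W'.conductorNorm ℤ)),
      9 ∣ W.conductorNorm ℤ → W'.conductorNorm ℤ = W.conductorNorm ℤ →
      IsIsogenous (W.quadraticTwist ((-3 : ℤ) : ℚ)) W' →
      congruenceNumber D.f = congruenceNumber D'.f := by
  intro W W' _ _ _ _ D D' h9 hN hiso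
  exact congruenceNumber_eq_of_isIsogenous_quadraticTwist_negThree D D' hN h9 h9 (by rw [hN]; exact h9) hiso

end Summit.BirchSwinnertonDyer.BirchSwinnertonDyer.Theorems.ManinLocalTwoThree

end
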